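import Literature.Probability.Percolation.KSTPeriodicWeak
import Literature.Probability.Percolation.KSTPeriodicDualMeasure
import Literature.Probability.Percolation.IsoradialProofs

/-!
# From the weak periodic RSW theorem to box-crossing bounds, part 3a: the lower sandwich

Support file for item `stmt-CriticalPhenomena-10267` (route `CardySelfRefinement`, crux
`CriticalPathRSW`, line finite-size-envelope, stub `stub_rswOfCertificates3`).

Transport of long-crossing bounds for a `kℤ²`-periodic measure `μ` on bond configurations of `ℤ²`
(class `KSTPeriodic.Admissible k 0`, lattice-carried) to LOWER bounds for the embedded crossing
events `embRectCrossing`/`embTBCrossing` of Euclidean rectangles `w + [0, a n] × [0, n]`,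
`w ∈ ℂ`, for the isoradial drawing `squareLatticeEmbedding.z = √2 · ℤ²` (Grimmett–Manolescu,
PTRF 159 (2014), §2.3: the box-crossing property of `ℤ²` is the RSW lemma; Grimmett,
*Percolation* (1999), §11.7), following `square_embRectCrossing_bounds` (`IsoradialProofs.lean`)
with the translations restricted to `kℤ²`: the embedded event contains the left–right crossing
of the lattice rectangle `[i, I] × [j, J]` read off from `w` (`lrRect_subset_embRectCrossing`),
which contains (narrowing, `lrRect_subset_lrRect`) a `kℤ²`-translate of the long crossing
`𝓒₀(ρ' N', N')`, `ρ' = 8(⌈a⌉ + 1)`, `N' = ⌊n/8⌋` (`embRectCrossing_lower`). Vertical crossings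
are horizontal crossings of the transposed picture
(`real_embTBCrossing_eq_real_embRectCrossing_of_transpose`).
-/

noncomputable section

namespace Summit.CriticalPhenomena.CardyFormulaZ2.Cruxes.CriticalPathRSW.FiniteSizeEnvelope

open Set MeasureTheory Filter Topology
open Literature.Probability.LatticeModels Literature.Probability.Percolation

namespace RswCertSandwich

/-! ### A lattice rectangle inside an embedded rectangle -/

/-- **A lattice rectangle inside an embedded one.** If the lattice rectangle `[i, I] × [j, J]`,
drawn by `v ↦ √2 v - w`, lies in the strip `[-2, A + 2] × [0, B]` with its left column in
`{re ≤ 0}` and its right column in `{A ≤ re}`, then its open left–right crossing is an open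
horizontal crossing of the Euclidean rectangle `[0, A] × [0, B]` (`embRectCrossing`, slack `2`). -/
theorem lrRect_subset_embRectCrossing (w : ℂ) (A B : ℝ) (i I j J : ℤ)
    (h1 : Real.sqrt 2 * i ≤ w.re) (h2 : w.re - 2 ≤ Real.sqrt 2 * i)
    (h3 : w.re + A ≤ Real.sqrt 2 * I) (h4 : Real.sqrt 2 * I ≤ w.re + A + 2)
    (h5 : w.im ≤ Real.sqrt 2 * j) (h6 : Real.sqrt 2 * J ≤ w.im + B) :
    KSTPeriodic.lrRect i I j J ⊆
      embRectCrossing (fun v => squareLatticeEmbedding.z v - w) A B := by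
  have hs : 0 < Real.sqrt 2 := Real.sqrt_pos.2 (by norm_num)
  refine openCrossing_mono ?_ ?_ ?_
  · intro x hx
    rw [KSTPeriodic.mem_rect] at hx
    obtain ⟨hx1, hx2, hx3, hx4⟩ := hx
    have e1 : (i : ℝ) ≤ x 0 := by exact_mod_cast hx1
    have e2 : (x 0 : ℝ) ≤ I := by exact_mod_cast hx2
    have e3 : (j : ℝ) ≤ x 1 := by exact_mod_cast hx3
    have e4 : (x 1 : ℝ) ≤ J := by exact_mod_cast hx4
    simp only [mem_setOf_eq, squareLatticeEmbedding_z_sub_re, squareLatticeEmbedding_z_sub_im, mem_Icc]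
    refine ⟨⟨?_, ?_⟩, ?_, ?_⟩ <;> nlinarith
  · rintro x ⟨-, hx⟩
    have e : (x 0 : ℝ) = i := by exact_mod_cast hx
    simp only [mem_setOf_eq, squareLatticeEmbedding_z_sub_re]
    rw [e]; linarith
  · rintro x ⟨-, hx⟩
    have e : (x 0 : ℝ) = I := by exact_mod_cast hx
    simp only [mem_setOf_eq, squareLatticeEmbedding_z_sub_re]
    rw [e]; linarith

/-! ### Vertical crossings by transposition -/

/-- Images under the transposition `(x₀, x₁) ↦ (x₁, x₀)`. -/
theorem image_transposeEquiv (S : Set (Site 2)) :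
    KSTPeriodic.transposeEquiv '' S = {v | (![v 1, v 0] : Site 2) ∈ S} := by
  ext v
  simp only [Set.mem_image, Set.mem_setOf_eq]
  constructor
  · rintro ⟨u, hu, rfl⟩
    rw [KSTPeriodic.transposeEquiv_apply]
    convert hu
    ext j; fin_cases j <;> simp
  · intro hv
    refine ⟨![v 1, v 0], hv, ?_⟩
    rw [KSTPeriodic.transposeEquiv_apply]
    ext j; fin_cases j <;> simp

/-- **Vertical crossings are horizontal crossings of the transposed picture.** For a measure
invariant under the transposition of `ℤ²`, the vertical crossing of `[0, A] × [0, B]` for the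
drawing `v ↦ √2 v - w` has the probability of the horizontal crossing of `[0, B] × [0, A]` for the
drawing `v ↦ √2 v - (im w, re w)`. -/
theorem real_embTBCrossing_eq_real_embRectCrossing_of_transpose {μ : Measure (BondConfig (Site 2))}
    (hμ : μ.map (KST2023.act KSTPeriodic.transposeEquiv) = μ) (w : ℂ) (A B : ℝ) :
    μ.real (embTBCrossing (fun v => squareLatticeEmbedding.z v - w) A B) =
      μ.real (embRectCrossing (fun v => squareLatticeEmbedding.z v - ⟨w.im, w.re⟩) B A) := by
  rw [embTBCrossing, ← KSTPeriodic.real_openCrossing_image hμ, embRectCrossing]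
  congr 2
  · rw [image_transposeEquiv]
    ext v
    simp only [mem_setOf_eq, squareLatticeEmbedding_z_sub_re, squareLatticeEmbedding_z_sub_im,
      Matrix.cons_val_zero, Matrix.cons_val_one]
    exact and_comm
  · rw [image_transposeEquiv]
    ext v
    simp only [mem_setOf_eq, squareLatticeEmbedding_z_sub_re, squareLatticeEmbedding_z_sub_im,
      Matrix.cons_val_zero, Matrix.cons_val_one]
  · rw [image_transposeEquiv]
    ext v
    simp only [mem_setOf_eq, squareLatticeEmbedding_z_sub_re, squareLatticeEmbedding_z_sub_im,
      Matrix.cons_val_zero, Matrix.cons_val_one]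

/-! ### Integer bookkeeping -/

/-- A multiple of `k` in the window `(x, x + k]`. -/
theorem lt_mul_ediv_add_one_le {k : ℕ} (hk : 1 ≤ k) (x : ℤ) :
    x < (k : ℤ) * (x / k + 1) ∧ (k : ℤ) * (x / k + 1) ≤ x + k := by
  have hk0 : (0 : ℤ) < k := by exact_mod_cast hk
  have h1 := Int.lt_mul_ediv_self_add (x := x) hk0
  have h2 := Int.mul_ediv_self_le (x := x) hk0.ne'
  constructor <;> linarith [mul_add (k : ℤ) (x / k) 1]

/-! ### The lower bound -/

/-- **Lower box-crossing bound from primal long crossings.** Let `μ` be admissible (offset `0`)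
and lattice-carried, with long crossings `μ(𝓒₀(ρ' N, N)) ≥ c₁` for all `N ≥ N₁` at the aspect
ratio `ρ' = 8 (⌈a⌉ + 1)`. Then for `n ≥ 8 (N₁ + k + 2) + 8a` and every `w ∈ ℂ` the Euclidean
rectangle `w + [0, a n] × [0, n]` is crossed horizontally by `√2 ℤ²` with `μ`-probability `≥ c₁`:
the embedded event contains the crossing of the lattice rectangle `[i, I] × [j, J]` read off from
`w` (`I - i < an + 4`, `J - j > n/2 - 2`), which contains a `kℤ²`-translate of the long crossing
of `R_0(ρ' N', N')`, `N' = ⌊n/8⌋` (wider and shorter). -/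
theorem embRectCrossing_lower {k : ℕ} (hk : 1 ≤ k) {μ : Measure (BondConfig (Site 2))}
    [IsProbabilityMeasure μ] (hμ : KSTPeriodic.Admissible k 0 μ) (hL : KSTPeriodic.LatticeCarried μ)
    {a : ℝ} (ha : 0 < a) {c₁ : ℝ} {N₁ : ℕ}
    (hlong : ∀ N : ℕ, N₁ ≤ N → c₁ ≤ μ.real (KSTPeriodic.crossing 0 (8 * (⌈a⌉₊ + 1) * N) N))
    {n : ℕ} (hn : 8 * ((N₁ : ℝ) + k + 2) + 8 * a ≤ n) (w : ℂ) :
    c₁ ≤ μ.real (embRectCrossing (fun v => squareLatticeEmbedding.z v - w) (a * n) n) := by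
  obtain ⟨hs1, hs2⟩ := one_lt_sqrt_two_and_lt_two
  -- translation of rectangle crossings by `kℤ²`, solved form
  have hshift : ∀ {t : ℕ} {ν : Measure (BondConfig (Site 2))}, KSTPeriodic.Admissible k t ν →
      ∀ (v₀ v₁ : ℤ) {a b c d a' b' c' d' : ℤ}, a' = a + k * v₀ → b' = b + k * v₀ →
        c' = c + k * v₁ → d' = d + k * v₁ →
        ν.real (KSTPeriodic.lrRect a' b' c' d') = ν.real (KSTPeriodic.lrRect a b c d) := by
    intro t ν hν v₀ v₁ a b c d a' b' c' d' ha hb hc hd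
    subst ha hb hc hd
    simpa using KSTPeriodic.real_lrRect_shift hν ![v₀, v₁] a b c d
  -- inclusions valid on lattice configurations give inequalities of probabilities
  have hmono : ∀ {ν : Measure (BondConfig (Site 2))} [IsFiniteMeasure ν], KSTPeriodic.LatticeCarried ν →
      ∀ {A B : Set (BondConfig (Site 2))},
        (∀ ω : BondConfig (Site 2), ω ⊆ (zdGraph 2).edgeSet → ω ∈ A → ω ∈ B) → ν.real A ≤ ν.real B := by
    intro ν _ hν A B h
    rw [measureReal_def, measureReal_def]
    exact ENNReal.toReal_mono (measure_ne_top ν B) (measure_mono_ae (hν.mono fun ω hω hA => h ω hω hA))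
  set s := Real.sqrt 2 with hs_def
  have hs0 : 0 < s := by linarith
  have hk' : (1 : ℝ) ≤ k := by exact_mod_cast hk
  have hn0 : (0 : ℝ) ≤ n := Nat.cast_nonneg n
  have han : 0 ≤ a * n := mul_nonneg ha.le hn0
  -- the lattice rectangle read off from `w`
  set i : ℤ := ⌊w.re / s⌋ with hi
  set I : ℤ := ⌈(w.re + a * n) / s⌉ with hI
  set j : ℤ := ⌈w.im / s⌉ with hj
  set J : ℤ := ⌊(w.im + n) / s⌋ with hJ
  have eL1 : s * i ≤ w.re := by
    have := Int.floor_le (w.re / s); rw [le_div_iff₀ hs0] at this; linarith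
  have eL2 : w.re < s * i + s := by
    have := Int.lt_floor_add_one (w.re / s); rw [div_lt_iff₀ hs0] at this; linarith
  have eR1 : w.re + a * n ≤ s * I := by
    have := Int.le_ceil ((w.re + a * n) / s); rw [div_le_iff₀ hs0] at this; linarith
  have eR2 : s * I < w.re + a * n + s := by
    have h := Int.ceil_lt_add_one ((w.re + a * n) / s)
    have h' : (I : ℝ) - 1 < (w.re + a * n) / s := by linarith
    rw [lt_div_iff₀ hs0] at h'; linarith
  have eB1 : w.im ≤ s * j := by
    have := Int.le_ceil (w.im / s); rw [div_le_iff₀ hs0] at this; linarith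
  have eB2 : s * j < w.im + s := by
    have h := Int.ceil_lt_add_one (w.im / s)
    have h' : (j : ℝ) - 1 < w.im / s := by linarith
    rw [lt_div_iff₀ hs0] at h'; linarith
  have eT1 : s * J ≤ w.im + n := by
    have := Int.floor_le ((w.im + n) / s); rw [le_div_iff₀ hs0] at this; linarith
  have eT2 : w.im + n < s * J + s := by
    have := Int.lt_floor_add_one ((w.im + n) / s); rw [div_lt_iff₀ hs0] at this; linarith
  -- the scale and the aspect ratio of the long crossing
  set N' : ℕ := ⌊(n : ℝ) / 8⌋₊ with hN'
  set ρ' : ℕ := 8 * (⌈a⌉₊ + 1) with hρ'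
  have hN'1 : (N' : ℝ) ≤ n / 8 := Nat.floor_le (by positivity)
  have hN'2 : (n : ℝ) / 8 < N' + 1 := Nat.lt_floor_add_one _
  have hρ'r : (ρ' : ℝ) = 8 * ((⌈a⌉₊ : ℝ) + 1) := by rw [hρ']; push_cast; ring
  have hceil : a ≤ ⌈a⌉₊ := Nat.le_ceil a
  have hN₁ : N₁ ≤ N' := by
    have : (N₁ : ℝ) < N' := by linarith
    exact_mod_cast this.le
  -- `ρ' N'` is wide enough
  have hP : a * n + 4 ≤ (ρ' : ℝ) * N' ∧ (k : ℝ) ≤ (ρ' : ℝ) * N' := by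
    have h1 : 8 * ((⌈a⌉₊ : ℝ) + 1) * (n / 8 - 1) ≤ (ρ' : ℝ) * N' := by
      rw [hρ'r]
      exact mul_le_mul_of_nonneg_left (by linarith) (by positivity)
    have h2 : (a + 1) * (n - 8) ≤ ((⌈a⌉₊ : ℝ) + 1) * (n - 8) :=
      mul_le_mul_of_nonneg_right (by linarith) (by linarith)
    have h3 : 8 * ((⌈a⌉₊ : ℝ) + 1) * (n / 8 - 1) = ((⌈a⌉₊ : ℝ) + 1) * (n - 8) := by ring
    have h4 : (a + 1) * (n - 8) = a * n + n - 8 * a - 8 := by ring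
    constructor <;> linarith
  have hPz : (k : ℤ) ≤ (ρ' : ℤ) * N' := by
    have h' : ((k : ℤ) : ℝ) ≤ (((ρ' : ℤ) * (N' : ℤ) : ℤ) : ℝ) := by push_cast; exact hP.2
    exact_mod_cast h'
  -- integer consequences
  have hiI : i ≤ I := by
    have : (i : ℝ) ≤ I := le_of_mul_le_mul_left (by linarith : s * i ≤ s * I) hs0
    exact_mod_cast this
  have hIi : I - i ≤ (ρ' : ℤ) * N' := by
    have h0 : (0 : ℝ) ≤ (I : ℝ) - i := by
      have : (i : ℝ) ≤ I := by exact_mod_cast hiI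
      linarith
    have h1 : s * ((I : ℝ) - i) < a * n + 2 * s := by
      have : s * ((I : ℝ) - i) = s * I - s * i := by ring
      linarith
    have h2 : ((I : ℝ) - i) < a * n + 4 := by
      have := mul_le_mul_of_nonneg_right hs1.le h0
      linarith
    have h3 : (((I - i : ℤ)) : ℝ) ≤ (((ρ' : ℤ) * (N' : ℤ) : ℤ) : ℝ) := by push_cast; linarith [hP.1]
    exact_mod_cast h3
  set v₀ : ℤ := i / k + 1 with hv₀
  set v₁ : ℤ := (j + N') / k + 1 with hv₁
  have hkv₀ : i < (k : ℤ) * v₀ ∧ (k : ℤ) * v₀ ≤ i + k := lt_mul_ediv_add_one_le hk i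
  have hkv₁ : j + N' < (k : ℤ) * v₁ ∧ (k : ℤ) * v₁ ≤ j + N' + k := lt_mul_ediv_add_one_le hk (j + N')
  have hJj : j + 2 * (N' : ℤ) + k ≤ J := by
    have h1 : s * ((J : ℝ) - j + 2) > n := by
      have : s * ((J : ℝ) - j + 2) = s * J - s * j + 2 * s := by ring
      linarith
    have h2 : (0 : ℝ) < (J : ℝ) - j + 2 := by
      by_contra hc
      rw [not_lt] at hc
      have := mul_le_mul_of_nonneg_left hc hs0.le
      linarith
    have h3 : ((J : ℝ) - j) > n / 2 - 2 := by
      have := mul_le_mul_of_nonneg_right hs2.le h2.le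
      linarith
    have h4 : ((j + 2 * (N' : ℤ) + k : ℤ) : ℝ) < (J : ℝ) := by push_cast; linarith
    have h5 : (j + 2 * (N' : ℤ) + k : ℤ) < J := by exact_mod_cast h4
    omega
  calc c₁ ≤ μ.real (KSTPeriodic.crossing 0 (ρ' * N') N') := hlong N' hN₁
    _ = μ.real (KSTPeriodic.lrRect (-((ρ' : ℤ) * N') + k * v₀) ((ρ' : ℤ) * N' + k * v₀)
          (-(N' : ℤ) + k * v₁) (N' + k * v₁)) := by
        rw [KSTPeriodic.crossing]
        exact (hshift hμ v₀ v₁ (by push_cast; ring) (by push_cast; ring)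
          (by push_cast; ring) rfl).symm
    _ ≤ μ.real (KSTPeriodic.lrRect i I j J) :=
        hmono hL fun ω hω h =>
          KSTPeriodic.lrRect_subset_lrRect hω (by linarith) hiI (by linarith) (by linarith)
            (by linarith) h
    _ ≤ μ.real (embRectCrossing (fun v => squareLatticeEmbedding.z v - w) (a * n) n) :=
        measureReal_mono (lrRect_subset_embRectCrossing w (a * n) n i I j J eL1 (by linarith) eR1
          (by linarith) eB1 eT1)

end RswCertSandwich

/-- **Headline of this support file** (registered sub-stub `stub_rswOfCertificates3_sandwichA`
of `stub_rswOfCertificates3`): lower box-crossing bounds for `√2 ℤ²` from primal long crossings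
of an admissible lattice-carried measure. -/
theorem stub_rswOfCertificates3_sandwichA :
    ∀ (k : ℕ), 1 ≤ k → ∀ (μ : Measure (BondConfig (Site 2))) [IsProbabilityMeasure μ],
      KSTPeriodic.Admissible k 0 μ → KSTPeriodic.LatticeCarried μ →
      ∀ (a : ℝ), 0 < a → ∀ (c₁ : ℝ) (N₁ : ℕ),
        (∀ N : ℕ, N₁ ≤ N → c₁ ≤ μ.real (KSTPeriodic.crossing 0 (8 * (⌈a⌉₊ + 1) * N) N)) →
        ∀ n : ℕ, 8 * ((N₁ : ℝ) + k + 2) + 8 * a ≤ n → ∀ w : ℂ,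
          c₁ ≤ μ.real (embRectCrossing (fun v => squareLatticeEmbedding.z v - w) (a * n) n) :=
  fun _ hk _ _ hμ hL _ ha _ _ hlong _ hn w => RswCertSandwich.embRectCrossing_lower hk hμ hL ha hlong hn w

end Summit.CriticalPhenomena.CardyFormulaZ2.Cruxes.CriticalPathRSW.FiniteSizeEnvelope

end
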